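import Mathlib
import Summits.CriticalPhenomena.PercolationContinuityZ3.Theorems.PercNearOneGluingNoHeavyLowerTailFatMinorityThreePortsU2
import Summits.CriticalPhenomena.PercolationContinuityZ3.Theorems.PercNearOneGluingNoHeavyLowerTailFatMinorityRT4OfUT4
import HarnessLib

/-!
# `NoHeavyLowerTail` (stmt-CriticalPhenomena-4575), line fat-minority-linear — THEOREM B of the notes in the tree: the up-set star
# inequality (UT4 + QUT4, every admissible threshold) for observers with AT MOST THREE ports, unconditionally (route task `nh-dp-fatminority`, gen 11)

`upsetStar_target_of_caseII`-style induction on `|A| ≤ 3`: the Case-II instances with no singleton member of `𝒰` either have a common port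
(`target_of_commonPort_caseII`) or are `𝒰₂ = {B ⊆ A : |B| ≥ 2}` on exactly three ports (`upsets_three_noCommon`), which is `caseII_target_U2` at the
least reliable port.  Result `upsetStar_target_card_le_three`: for every weighting on `Fin n`, every observer `o ∉ A` isolated off `A` (no loop) with
`|A| ≤ 3`, every up-set `𝒰 ∌ ∅`, every `c ≠ o` and every admissible `t`:  `μ({c↔b} ∩ U) − μ({o↔b} ∩ U) ≤ t·μ(U)` — Kozma–Nitzan's Theorem 4 on every
up-set (UT4, `t = 0`) and its quantitative negative side (QUT4) for stars with at most three ports; with `rt4_of_ut4`, the restricted Theorem 4 there.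
No definitions.
-/

namespace Summit.CriticalPhenomena.PercolationContinuityZ3.Theorems

open MeasureTheory Set
open Literature.Probability.LatticeModels (prodBernoulli)
open Literature.Probability.Percolation

noncomputable section
open scoped Classical

variable {n : ℕ}

/-- **Up-sets on at most three ports without singletons and without a common port are `𝒰₂`.**  If `|A| ≤ 3`, `𝒰 ⊆ 𝒫(A)` is nonempty,
up-closed, `∅ ∉ 𝒰`, no singleton is a member and no port lies in every member, then `|A| = 3` and `𝒰 = {B ⊆ A : |B| ≥ 2}`. [folklore] -/
theorem upsets_three_noCommon (A : Finset (Fin n)) (hA : A.card ≤ 3) (𝒰 : Finset (Finset (Fin n)))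
    (h𝒰A : 𝒰 ⊆ A.powerset) (h0 : ∅ ∉ 𝒰) (hup : ∀ B ∈ 𝒰, ∀ B' ∈ A.powerset, B ⊆ B' → B' ∈ 𝒰)
    (hsing : ∀ z ∈ A, ({z} : Finset (Fin n)) ∉ 𝒰) (hne : 𝒰.Nonempty)
    (hnocommon : ∀ a ∈ A, ∃ B ∈ 𝒰, a ∉ B) :
    A.card = 3 ∧ 𝒰 = A.powerset.filter (fun B => 2 ≤ B.card) := by
  -- every member has at least two elements
  have hcard2 : ∀ B ∈ 𝒰, 2 ≤ B.card := by
    intro B hB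
    have hBA : B ⊆ A := Finset.mem_powerset.1 (h𝒰A hB)
    by_contra hlt
    push Not at hlt
    interval_cases hcB : B.card
    · exact h0 (Finset.card_eq_zero.1 hcB ▸ hB)
    · obtain ⟨z, hz⟩ := Finset.card_eq_one.1 hcB
      subst hz
      exact hsing z (hBA (Finset.mem_singleton_self z)) hB
  -- `|A| = 3`: otherwise every member is `A` itself and any port is common
  obtain ⟨B₀, hB₀⟩ := hne
  have hB₀A : B₀ ⊆ A := Finset.mem_powerset.1 (h𝒰A hB₀)
  have hA2 : 2 ≤ A.card := (hcard2 B₀ hB₀).trans (Finset.card_le_card hB₀A)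
  have hA3 : A.card = 3 := by
    by_contra hne3
    have hAle2 : A.card ≤ 2 := by omega
    have hall : ∀ B ∈ 𝒰, B = A := fun B hB =>
      Finset.eq_of_subset_of_card_le (Finset.mem_powerset.1 (h𝒰A hB)) (hAle2.trans (hcard2 B hB))
    have hAne : A.Nonempty := Finset.card_pos.1 (by omega)
    obtain ⟨a, haA⟩ := hAne
    obtain ⟨B, hB, haB⟩ := hnocommon a haA
    exact haB (hall B hB ▸ haA)
  refine ⟨hA3, ?_⟩
  -- every pair `A ∖ {a}` is a member
  have hpair : ∀ a ∈ A, A.erase a ∈ 𝒰 := by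
    intro a haA
    obtain ⟨B, hB, haB⟩ := hnocommon a haA
    have hBsub : B ⊆ A.erase a := fun y hy =>
      Finset.mem_erase.2 ⟨fun h => haB (h ▸ hy), Finset.mem_powerset.1 (h𝒰A hB) hy⟩
    have hcardE : (A.erase a).card = 2 := by rw [Finset.card_erase_of_mem haA, hA3]
    have hBeq : B = A.erase a := Finset.eq_of_subset_of_card_le hBsub (by rw [hcardE]; exact hcard2 B hB)
    exact hBeq ▸ hB
  ext B
  rw [Finset.mem_filter]
  constructor
  · intro hB; exact ⟨h𝒰A hB, hcard2 B hB⟩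
  · rintro ⟨hBA, hcB⟩
    have hBsub : B ⊆ A := Finset.mem_powerset.1 hBA
    by_cases hBeq : B = A
    · -- `A` itself: up-closure of any pair
      obtain ⟨a, haA⟩ : A.Nonempty := Finset.card_pos.1 (by omega)
      exact hup (A.erase a) (hpair a haA) B hBA (hBeq ▸ Finset.erase_subset a A)
    · -- a proper subset with ≥ 2 of 3 elements misses exactly one port
      have hlt : B.card < A.card := Finset.card_lt_card (lt_of_le_of_ne hBsub hBeq)
      obtain ⟨a, haA, haB⟩ : ∃ a ∈ A, a ∉ B := by
        by_contra h
        push Not at h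
        exact hBeq (Finset.Subset.antisymm hBsub (fun a ha => h a ha))
      have hBsub' : B ⊆ A.erase a := fun y hy => Finset.mem_erase.2 ⟨fun h => haB (h ▸ hy), hBsub hy⟩
      have hcardE : (A.erase a).card = 2 := by rw [Finset.card_erase_of_mem haA, hA3]
      have hBeq' : B = A.erase a := Finset.eq_of_subset_of_card_le hBsub' (by rw [hcardE]; exact hcB)
      exact hBeq' ▸ hpair a haA

/-- **THEOREM B (≤ 3 ports): the up-set star inequality, unconditionally.**  See the module docstring.
[cite: KozmaNitzan2024, Thm. 4 p. 13, Lemma 3 p. 6, Lemma 4 p. 9, Lemma 5 p. 13; VandenbergHaggstromKahn2005, Thm. 1.4/1.5 (p. 7); proof: route notes gen 8 (THEOREM B), gen 9 (U₂), gen 11 (assembly)] -/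
theorem upsetStar_target_card_le_three (w : Sym2 (Fin n) → unitInterval) (A : Finset (Fin n)) (o b c : Fin n)
    (hA : A.card ≤ 3) (hoA : o ∉ A) (hiso : ∀ u, u ≠ o → u ∉ A → w s(o, u) = 0) (hloop : w s(o, o) = 0)
    (𝒰 : Finset (Finset (Fin n))) (h𝒰A : 𝒰 ⊆ A.powerset) (h0 : ∅ ∉ 𝒰)
    (hup : ∀ B ∈ 𝒰, ∀ B' ∈ A.powerset, B ⊆ B' → B' ∈ 𝒰) (hco : c ≠ o) (t : ℝ) (ht : 0 ≤ t)
    (hgap : ∀ v ∈ A, (prodBernoulli w).real (openConn c b) - (prodBernoulli w).real (openConn v b) ≤ t) :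
    (prodBernoulli w).real (openConn c b ∩ {ω | ∃ B ∈ 𝒰, ∀ u ∈ B, s(o, u) ∈ ω}) -
        (prodBernoulli w).real (openConn o b ∩ {ω | ∃ B ∈ 𝒰, ∀ u ∈ B, s(o, u) ∈ ω}) ≤
      t * (prodBernoulli w).real {ω | ∃ B ∈ 𝒰, ∀ u ∈ B, s(o, u) ∈ ω} := by
  -- Case II with no singleton on ≤ 3 ports: common port, or `𝒰₂` on exactly three ports
  have hC2 : ∀ (w' : Sym2 (Fin n) → unitInterval) (A' : Finset (Fin n)) (c' : Fin n)
      (𝒰' : Finset (Finset (Fin n))) (t' : ℝ),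
      o ∉ A' → (∀ u, u ≠ o → u ∉ A' → w' s(o, u) = 0) → w' s(o, o) = 0 → c' ≠ o →
      𝒰' ⊆ A'.powerset → ∅ ∉ 𝒰' → (∀ B ∈ 𝒰', ∀ B' ∈ A'.powerset, B ⊆ B' → B' ∈ 𝒰') →
      (∀ z ∈ A', ({z} : Finset (Fin n)) ∉ 𝒰') →
      (∀ z ∈ A', (prodBernoulli (Function.update w' s(o, z) 1)).real (openConn c' b) <
        (prodBernoulli (Function.update w' s(o, z) 1)).real (openConn z b)) →
      0 ≤ t' → (∀ v ∈ A', (prodBernoulli w').real (openConn c' b) - (prodBernoulli w').real (openConn v b) ≤ t') →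
      A'.card ≤ 3 →
      (prodBernoulli w').real (openConn c' b ∩ {ω | ∃ B ∈ 𝒰', ∀ u ∈ B, s(o, u) ∈ ω}) -
          (prodBernoulli w').real (openConn o b ∩ {ω | ∃ B ∈ 𝒰', ∀ u ∈ B, s(o, u) ∈ ω}) ≤
        t' * (prodBernoulli w').real {ω | ∃ B ∈ 𝒰', ∀ u ∈ B, s(o, u) ∈ ω} := by
    intro w' A' c' 𝒰' t' hoA' hiso' hloop' hco' h𝒰A' h0' hup' hsing hII ht' hgap' hA'
    have hU0 : 0 ≤ (prodBernoulli w').real {ω : BondConfig (Fin n) | ∃ B ∈ 𝒰', ∀ u ∈ B, s(o, u) ∈ ω} :=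
      measureReal_nonneg
    rcases 𝒰'.eq_empty_or_nonempty with he | hne
    · have hU : {ω : BondConfig (Fin n) | ∃ B ∈ 𝒰', ∀ u ∈ B, s(o, u) ∈ ω} = ∅ := by ext ω; simp [he]
      simp [hU]
    by_cases hbo : b = o
    · -- `b = o`: `{o ↔ b}` is everything
      subst hbo
      have huniv : (openConn b b : Set (BondConfig (Fin n))) = Set.univ := by
        ext ω; simp only [openConn, mem_setOf_eq, mem_univ, iff_true]; exact SimpleGraph.Reachable.refl _
      rw [huniv, Set.univ_inter]
      have hle : (prodBernoulli w').real (openConn c' b ∩ {ω | ∃ B ∈ 𝒰', ∀ u ∈ B, s(b, u) ∈ ω}) ≤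
          (prodBernoulli w').real {ω | ∃ B ∈ 𝒰', ∀ u ∈ B, s(b, u) ∈ ω} := measureReal_mono inter_subset_right
      nlinarith [hle, hU0, ht']
    by_cases hcommon : ∃ a ∈ A', ∀ B ∈ 𝒰', a ∈ B
    · obtain ⟨a, haA', hcom⟩ := hcommon
      exact target_of_commonPort_caseII w' A' o a c' b hoA' haA' 𝒰' h𝒰A' hcom (hII a haA').le t' ht'
    · push Not at hcommon
      obtain ⟨hA3, h𝒰eq⟩ := upsets_three_noCommon A' hA' 𝒰' h𝒰A' h0' hup' hsing hne hcommon
      -- the least reliable port `v` and the other two ports `u, q`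
      have hA'ne : A'.Nonempty := Finset.card_pos.1 (by omega)
      obtain ⟨v, hvA', hvmin⟩ := Finset.exists_min_image A' (fun z => (prodBernoulli w').real (openConn z b)) hA'ne
      have hcardE : (A'.erase v).card = 2 := by rw [Finset.card_erase_of_mem hvA', hA3]
      obtain ⟨u, q, huq, huqE⟩ := Finset.card_eq_two.1 hcardE
      have huE : u ∈ A'.erase v := by rw [huqE]; simp
      have hqE : q ∈ A'.erase v := by rw [huqE]; simp
      have hvu : v ≠ u := fun h => (Finset.mem_erase.1 huE).1 h.symm
      have hvq : v ≠ q := fun h => (Finset.mem_erase.1 hqE).1 h.symm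
      have huA' : u ∈ A' := Finset.mem_of_mem_erase huE
      have hqA' : q ∈ A' := Finset.mem_of_mem_erase hqE
      have hAeq : A' = {v, u, q} := by
        rw [← Finset.insert_erase hvA', huqE]
      have hvo : v ≠ o := fun h => hoA' (h ▸ hvA')
      have huo : u ≠ o := fun h => hoA' (h ▸ huA')
      have hqo : q ≠ o := fun h => hoA' (h ▸ hqA')
      exact caseII_target_U2 w' A' o v u q c' b hAeq hvo huo hqo hvu hvq huq hco' hbo hiso' hloop'
        (fun z hz => hvmin z hz) (hII v hvA').le 𝒰' h𝒰eq t' ht' hgap'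
  -- the induction on `|A|`, keeping `|A| ≤ 3`
  suffices key : ∀ (k : ℕ) (w : Sym2 (Fin n) → unitInterval) (A : Finset (Fin n)), A.card ≤ k → A.card ≤ 3 → o ∉ A →
      (∀ u, u ≠ o → u ∉ A → w s(o, u) = 0) → w s(o, o) = 0 →
      ∀ 𝒰 : Finset (Finset (Fin n)), 𝒰 ⊆ A.powerset → ∅ ∉ 𝒰 →
        (∀ B ∈ 𝒰, ∀ B' ∈ A.powerset, B ⊆ B' → B' ∈ 𝒰) →
        ∀ c : Fin n, c ≠ o → ∀ t : ℝ, 0 ≤ t →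
          (∀ v ∈ A, (prodBernoulli w).real (openConn c b) - (prodBernoulli w).real (openConn v b) ≤ t) →
          (prodBernoulli w).real (openConn c b ∩ {ω | ∃ B ∈ 𝒰, ∀ u ∈ B, s(o, u) ∈ ω}) -
              (prodBernoulli w).real (openConn o b ∩ {ω | ∃ B ∈ 𝒰, ∀ u ∈ B, s(o, u) ∈ ω}) ≤
            t * (prodBernoulli w).real {ω | ∃ B ∈ 𝒰, ∀ u ∈ B, s(o, u) ∈ ω} from
    key A.card w A le_rfl hA hoA hiso hloop 𝒰 h𝒰A h0 hup c hco t ht hgap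
  intro k
  induction k with
  | zero =>
    intro w A hA _ hoA hiso hloop 𝒰 h𝒰A h0 hup c hco t ht0 hgap
    have hAe : A = ∅ := Finset.card_eq_zero.1 (Nat.le_zero.1 hA)
    have h𝒰e : 𝒰 = ∅ := by
      refine Finset.eq_empty_of_forall_notMem fun B hB => h0 ?_
      have hBA := Finset.mem_powerset.1 (h𝒰A hB)
      rw [hAe, Finset.subset_empty] at hBA
      exact hBA ▸ hB
    have hU : {ω : BondConfig (Fin n) | ∃ B ∈ 𝒰, ∀ u ∈ B, s(o, u) ∈ ω} = ∅ := by ext ω; simp [h𝒰e]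
    simp [hU]
  | succ k ih =>
    intro w A hA hA3 hoA hiso hloop 𝒰 h𝒰A h0 hup c hco t ht0 hgap
    have hIH' : ∀ z ∈ A, ∀ c' : Fin n, c' ≠ o → ∀ t' : ℝ, 0 ≤ t' →
        (∀ v ∈ A.erase z, (prodBernoulli (Function.update w s(o, z) 0)).real (openConn c' b) -
            (prodBernoulli (Function.update w s(o, z) 0)).real (openConn v b) ≤ t') →
        ∀ 𝒰' : Finset (Finset (Fin n)), 𝒰' ⊆ (A.erase z).powerset → ∅ ∉ 𝒰' →
          (∀ B ∈ 𝒰', ∀ B' ∈ (A.erase z).powerset, B ⊆ B' → B' ∈ 𝒰') →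
          (prodBernoulli (Function.update w s(o, z) 0)).real
                (openConn c' b ∩ {ω | ∃ B ∈ 𝒰', ∀ u ∈ B, s(o, u) ∈ ω}) -
              (prodBernoulli (Function.update w s(o, z) 0)).real
                (openConn o b ∩ {ω | ∃ B ∈ 𝒰', ∀ u ∈ B, s(o, u) ∈ ω}) ≤
            t' * (prodBernoulli (Function.update w s(o, z) 0)).real {ω | ∃ B ∈ 𝒰', ∀ u ∈ B, s(o, u) ∈ ω} := by
      intro z hzA c' hc' t' ht' hdom 𝒰' h𝒰' h0' hup'
      have hzo : z ≠ o := fun h => hoA (h ▸ hzA)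
      have hcard : (A.erase z).card ≤ k := by rw [Finset.card_erase_of_mem hzA]; omega
      have hcard3 : (A.erase z).card ≤ 3 := (Finset.card_erase_le).trans hA3
      have hoA' : o ∉ A.erase z := fun h => hoA (Finset.mem_of_mem_erase h)
      have hiso' : ∀ u, u ≠ o → u ∉ A.erase z → Function.update w s(o, z) 0 s(o, u) = 0 := by
        intro u huo hu
        by_cases huz : u = z
        · subst huz; simp only [Function.update_self]
        · have hne : s(o, u) ≠ s(o, z) := fun h => huz (Sym2.congr_right.mp h)
          simp only [Function.update_of_ne hne]
          exact hiso u huo (fun huA => hu (Finset.mem_erase.2 ⟨huz, huA⟩))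
      have hloop' : Function.update w s(o, z) 0 s(o, o) = 0 := by
        have hne : s(o, o) ≠ s(o, z) := fun h => hzo (Sym2.congr_right.mp h).symm
        simp only [Function.update_of_ne hne]; exact hloop
      exact ih (Function.update w s(o, z) 0) (A.erase z) hcard hcard3 hoA' hiso' hloop' 𝒰' h𝒰' h0' hup' c' hc' t' ht' hdom
    by_cases hsing : ∃ z ∈ A, ({z} : Finset (Fin n)) ∈ 𝒰
    · obtain ⟨z, hzA, hz⟩ := hsing
      exact upsetStar_port_step w A o z c b hoA hzA hco hiso hloop 𝒰 h𝒰A h0 hup t ht0 hgap (Or.inl hz) (hIH' z hzA)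
    · push Not at hsing
      by_cases hI : ∃ z ∈ A, (prodBernoulli (Function.update w s(o, z) 1)).real (openConn z b) ≤
          (prodBernoulli (Function.update w s(o, z) 1)).real (openConn c b)
      · obtain ⟨z, hzA, hz⟩ := hI
        exact upsetStar_port_step w A o z c b hoA hzA hco hiso hloop 𝒰 h𝒰A h0 hup t ht0 hgap (Or.inr hz) (hIH' z hzA)
      · push Not at hI
        exact hC2 w A c 𝒰 t hoA hiso hloop hco h𝒰A h0 hup hsing hI ht0 hgap hA3

/-- **RT4 for stars with at most three ports, unconditionally** (THEOREM B + THEOREM C): if `o ∉ A` is an observer whose positive-weight pairs go to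
`A` (no loop), `|A| ≤ 3`, and `c ≠ o` is at most as reliable as every port (`μ(c↔b) ≤ μ(v↔b)` for `v ∈ A`, Kozma–Nitzan's hypothesis), then for every
decreasing event `Q` determined by the open edge cluster of `c`:  `μ({c↔b} ∩ Q ∩ {o attached}) ≤ μ({o↔b} ∩ Q)`.
[cite: KozmaNitzan2024, Thm. 4 p. 13, Lemma 3 p. 6, Lemma 4 p. 9, Lemma 5 p. 13; VandenbergHaggstromKahn2005, Thm. 1.1 (p. 3), Thm. 1.4/1.5 (p. 7); route notes gen 8 (THEOREMS B, C)] -/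
theorem rt4_card_le_three (w : Sym2 (Fin n) → unitInterval) (A : Finset (Fin n)) (o c b : Fin n)
    (hA : A.card ≤ 3) (hoA : o ∉ A) (hiso : ∀ u, u ≠ o → u ∉ A → w s(o, u) = 0) (hloop : w s(o, o) = 0)
    (hco : c ≠ o) (hH1 : ∀ v ∈ A, (prodBernoulli w).real (openConn c b) ≤ (prodBernoulli w).real (openConn v b))
    (Q : Set (BondConfig (Fin n)))
    (hQ : ∀ ω ω', ω ∈ Q → openEdgeCluster ω' c ⊆ openEdgeCluster ω c → ω' ∈ Q) :
    (prodBernoulli w).real (openConn c b ∩ Q ∩ {ω | ∃ u ∈ A, s(o, u) ∈ ω}) ≤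
      (prodBernoulli w).real (openConn o b ∩ Q) := by
  refine rt4_of_ut4 w A o c b hoA hiso hloop Q hQ fun 𝒰 h𝒰A h0 hup => ?_
  have h := upsetStar_target_card_le_three w A o b c hA hoA hiso hloop 𝒰 h𝒰A h0 hup hco 0 le_rfl
    (fun v hv => by linarith [hH1 v hv])
  linarith

end

end Summit.CriticalPhenomena.PercolationContinuityZ3.Theorems
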